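import Literature.AnabelianGeometry.SemiGraphs.TemperedConfinedOfTopCyclicTree
import Literature.AnabelianGeometry.SemiGraphs.TemperedReconstructionR3cOfTwoHosts
import Literature.AnabelianGeometry.SemiGraphs.TemperedPiRayApartment
import HarnessLib

/-!
# [SemiAnbd] Cor 3.9 (R3c) `EdgeLikeCentralizerAt` at EVERY chart of every TREE-shaped graph of anabelioids
# with TOPOLOGICALLY CYCLIC edge groups — any valence (proof-only)

Mochizuki, *Semi-graphs of anabelioids*, Publ. RIMS **42** (2006), §3, Corollary 3.9, proof p. 43 l. 13
("[again by Theorem 3.7, (iii), (iv)]" — the cell's step (R3c), FACT-LIST rows F-2772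
`EdgeLikeCentralizerAt` / F-2773 `EdgeLikeCentralizer`) [cite: MochizukiSemiAnbd2006, Cor 3.9 p.43].

PROOF-ONLY (cell abc-iut, block F, seat abc-iut-f-175 gen 3; brick (D), the assembly of
«CONFINED@TOP-CYCLIC-TREES»; no definition, no named fact).
* `exists_fixed_branch_at_host_of_two_hosts` — at the canonical tower, a subgroup `C` lying in verticial
  subgroups at BOTH end-vertices `v₀ ≠ u₀` of a base edge `e₀` fixes, at every level, the edge of a branch
  over the branch `b₀` of `e₀` at some vertex over `v₀` (the `C`-fixed geodesic between the two host systems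
  covers the base path `v₀ — b₀ — e₀ — b₀' — u₀`).
* `centralizer_le_verticial_of_topCyclic_of_isAcyclic` — canonical chart, `𝔾` with ACYCLIC subdivision, all
  edge groups topologically cyclic: for a compact `C ≠ 1` with hosts at both ends of `e₀`, the centraliser of
  `C` lies in EVERY verticial subgroup containing `C` (brick (C) `confined_of_topCyclic_of_isAcyclic` +
  abc-iut-f-172's `mem_verticial_of_centralizer_of_confined`).
* `edgeLikeCentralizerAt_of_topCyclic_of_isAcyclic` — **F-2772 `EdgeLikeCentralizerAt ℋ c` at EVERY chart
  of every graph of anabelioids `ℋ` satisfying the hypotheses of Cor. 3.9 whose underlying graph is a TREE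
  (any valences, infinitely-branching cores included) and all of whose edge groups are topologically cyclic
  (`ℤ_p`, `Ẑ(1)`, …)**; `edgeLikeCentralizer_of_topCyclic_of_isAcyclic` — F-2773 RESTRICTED to that class,
  hypothesis-free.  Complementary to abc-iut-f-176's TAME class (finitely many dangerous branches at each
  vertex of infinite valence, arbitrary edge groups): here the valence pattern is arbitrary and the edge
  groups are constrained; e.g. the ℵ₀-regular tree with branch groups `⟨ab^λ⟩ ≤ F̂_p⟨a,b⟩` is covered.

Honest framing: statements about OUR typed tempered fundamental groups; the bare ∀-closure F-2773 (graphs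
with an infinitely-branching core AND a non-topologically-cyclic edge group, or with cycles) is NOT claimed;
cone-irrelevant beyond finite dual graphs; no side taken on [IUTchIII] Cor. 3.12; typed ≠ proved elsewhere.
-/

namespace Literature.AnabelianGeometry.SemiGraphs

namespace ProfiniteSemiGraph

open CategoryTheory Topology

universe u

variable (𝒢 : ProfiniteSemiGraph.{u}) (h37 : 𝒢.Thm37Hypotheses)

/-- **A fixed branch over `b₀` at a vertex over `v₀`, at every level, from two hosts.**  At the canonical
tower: if `C` lies in a verticial subgroup at `v₀` and in one at `u₀ ≠ v₀`, the two ends of the base edge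
`e₀` with branches `b₀ ≠ b₀'`, then at every level some vertex over `v₀` carries a branch over `b₀` whose edge
is `C`-fixed (the `C`-fixed geodesic joining the two host systems covers the base path
`v₀ — b₀ — e₀ — b₀' — u₀`). [cite: MochizukiSemiAnbd2006, Thm 3.7(iii) p.41] -/
theorem exists_fixed_branch_at_host_of_two_hosts (hbase : 𝒢.graph.subdivision.IsAcyclic)
    (C : Subgroup (𝒢.temperedPiChart h37.toProp36Hypotheses).G) {v₀ u₀ : 𝒢.graph.Vertex} {b₀ b₀' : 𝒢.graph.Branch} (hb₀ : 𝒢.graph.abuts b₀ = some v₀)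
    (hb₀' : 𝒢.graph.abuts b₀' = some u₀) (hbb : b₀ ≠ b₀') (he : 𝒢.graph.edgeOf b₀' = 𝒢.graph.edgeOf b₀)
    (hvu : v₀ ≠ u₀) {H₀ H₁ : Subgroup (𝒢.temperedPiChart h37.toProp36Hypotheses).G}
    (hH₀ : H₀ ∈ verticialSubgroups (𝒢.temperedPiChart h37.toProp36Hypotheses) v₀)
    (hH₁ : H₁ ∈ verticialSubgroups (𝒢.temperedPiChart h37.toProp36Hypotheses) u₀)
    (hC₀ : C ≤ H₀) (hC₁ : C ≤ H₁) (j : ℕ) :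
    ∃ (a : ((𝒢.galoisLevelData h37.toProp36Hypotheses).tree j).Vertex)
      (δ : ((𝒢.galoisLevelData h37.toProp36Hypotheses).tree j).Branch),
      ((𝒢.galoisLevelData h37.toProp36Hypotheses).treeProj j).vertexMap a = v₀ ∧
      ((𝒢.galoisLevelData h37.toProp36Hypotheses).tree j).abuts δ = some a ∧
      ((𝒢.galoisLevelData h37.toProp36Hypotheses).treeProj j).branchMap δ = b₀ ∧
      ∀ g ∈ C, ((𝒢.galoisLevelData h37.toProp36Hypotheses).treeAct h37.toProp36Hypotheses.isCountable j g).hom.edgeMap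
          (((𝒢.galoisLevelData h37.toProp36Hypotheses).tree j).edgeOf δ) =
        ((𝒢.galoisLevelData h37.toProp36Hypotheses).tree j).edgeOf δ := by
  classical
  let D := 𝒢.galoisLevelData h37.toProp36Hypotheses
  let hc := h37.toProp36Hypotheses.isCountable
  -- the host systems, from point sequences over `v₀` and `u₀`
  obtain ⟨ψ₀, hψ₀, rfl⟩ := hH₀
  obtain ⟨ψ₁, hψ₁, rfl⟩ := hH₁
  obtain ⟨P₀, hP₀⟩ := exists_pointSeq_of_isVerticialHom (h36 := h37.toProp36Hypotheses) hψ₀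
  obtain ⟨P₁, hP₁⟩ := exists_pointSeq_of_isVerticialHom (h36 := h37.toProp36Hypotheses) hψ₁
  have hfix₀ : ∀ g ∈ C, (D.treeAct hc j g).hom.vertexMap (P₀.vertex j) = P₀.vertex j := by
    intro g hg
    obtain ⟨h, hh⟩ := hC₀ hg
    rw [← hh, ← hP₀]
    exact P₀.treeAct_decompHom_vertexMap j h
  have hfix₁ : ∀ g ∈ C, (D.treeAct hc j g).hom.vertexMap (P₁.vertex j) = P₁.vertex j := by
    intro g hg
    obtain ⟨h, hh⟩ := hC₁ hg
    rw [← hh, ← hP₁]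
    exact P₁.treeAct_decompHom_vertexMap j h
  -- the `C`-fixed geodesic between them
  have hT := (D.isTree_tree j).isTree
  let p : (D.tree j).subdivision.Path (Sum.inl (P₀.vertex j)) (Sum.inl (P₁.vertex j)) :=
    (hT.connected _ _).some.toPath
  have hpfix : ∀ z ∈ p.1.support, ∀ g ∈ C, SemiGraph.nodeMap (D.treeAct hc j g) z = z := by
    intro z hz g hg
    have h1 : SemiGraph.nodeMap (D.treeAct hc j g) (Sum.inl (P₀.vertex j)) = Sum.inl (P₀.vertex j) := by
      simp [hfix₀ g hg]
    have h2 : SemiGraph.nodeMap (D.treeAct hc j g) (Sum.inl (P₁.vertex j)) = Sum.inl (P₁.vertex j) := by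
      simp [hfix₁ g hg]
    exact SemiGraph.nodeMap_eq_self_of_isPath hT.isAcyclic _ h1 h2 p.1 p.2 z hz
  -- the base path `v₀ — b₀ — e₀ — b₀' — u₀`
  have a₁ : 𝒢.graph.subdivision.Adj (Sum.inl v₀) (Sum.inr (Sum.inr b₀)) :=
    (𝒢.graph.subdivision_adj_inl_iff v₀ _).mpr ⟨b₀, hb₀, rfl⟩
  have a₂ : 𝒢.graph.subdivision.Adj (Sum.inr (Sum.inr b₀)) (Sum.inr (Sum.inl (𝒢.graph.edgeOf b₀))) :=
    (𝒢.graph.subdivision_adj_branch_iff b₀ _).mpr (Or.inl rfl)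
  have a₃ : 𝒢.graph.subdivision.Adj (Sum.inr (Sum.inl (𝒢.graph.edgeOf b₀))) (Sum.inr (Sum.inr b₀')) :=
    (𝒢.graph.subdivision_adj_edge_iff _ _).mpr ⟨b₀', he, rfl⟩
  have a₄ : 𝒢.graph.subdivision.Adj (Sum.inr (Sum.inr b₀')) (Sum.inl u₀) :=
    (𝒢.graph.subdivision_adj_branch_iff b₀' _).mpr (Or.inr ⟨u₀, hb₀', rfl⟩)
  have e₀' : Sum.inl ((D.treeProj j).vertexMap (P₀.vertex j)) = (Sum.inl v₀ : 𝒢.graph.Node) := by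
    rw [P₀.treeProj_vertexMap_vertex]
  have e₁' : Sum.inl ((D.treeProj j).vertexMap (P₁.vertex j)) = (Sum.inl u₀ : 𝒢.graph.Node) := by
    rw [P₁.treeProj_vertexMap_vertex]
  let B : 𝒢.graph.subdivision.Walk (Sum.inl ((D.treeProj j).vertexMap (P₀.vertex j)))
      (Sum.inl ((D.treeProj j).vertexMap (P₁.vertex j))) :=
    (SimpleGraph.Walk.cons a₁ (SimpleGraph.Walk.cons a₂ (SimpleGraph.Walk.cons a₃
      (SimpleGraph.Walk.cons a₄ SimpleGraph.Walk.nil)))).copy e₀'.symm e₁'.symm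
  have hB : B.IsPath := by
    refine SimpleGraph.Walk.IsPath.mk' ?_
    have h1 : (Sum.inr (Sum.inr b₀) : 𝒢.graph.Node) ≠ Sum.inr (Sum.inr b₀') := by simpa using hbb
    have h2 : (Sum.inl v₀ : 𝒢.graph.Node) ≠ Sum.inl u₀ := by simpa using hvu
    simp [B, SimpleGraph.Walk.support_copy, h1, h2]
  have hb₀B : (Sum.inr (Sum.inr b₀) : 𝒢.graph.Node) ∈ B.support := by
    simp [B, SimpleGraph.Walk.support_copy]
  obtain ⟨δ, hδp, hδb⟩ :=
    SemiGraph.exists_branch_mem_support_of_mem_geodesic hbase (D.treeProj j) p.1 B hB hb₀B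
  -- `δ` is interior: it abuts to a vertex `t` on the path, over `v₀`; its edge is `C`-fixed
  obtain ⟨-, t, hδt, -⟩ := SemiGraph.edge_and_vertex_mem_support_of_branch_mem_support p.1 p.2 hδp (by simp)
  have htv₀ : (D.treeProj j).vertexMap t = v₀ := by
    have h := (D.treeProj j).abuts_branchMap δ t hδt
    rw [hδb, hb₀] at h
    exact (Option.some.inj h).symm
  refine ⟨t, δ, htv₀, hδt, hδb, fun g hg => ?_⟩
  have h := hpfix _ hδp g hg
  simp only [SemiGraph.nodeMap_inr_inr, Sum.inr.injEq] at h
  rw [← (D.treeAct hc j g).hom.edgeOf_branchMap δ, h]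

/-- **The centraliser lies in every verticial host — tree-shaped `𝔾`, topologically cyclic edge groups, any
valence** (canonical chart).  For `𝒢` satisfying the hypotheses of Thm. 3.7 with ACYCLIC subdivision and
topologically cyclic edge groups, a compact `C ≠ 1` with verticial hosts at BOTH ends `v₀ ≠ u₀` of a base
edge `e₀`, and ANY verticial `H ⊇ C`: `centralizer C ≤ H` — the pair `(y, g·y)` is confined over `e₀`
(`confined_of_topCyclic_of_isAcyclic`), then abc-iut-f-172's `mem_verticial_of_centralizer_of_confined`.
[cite: MochizukiSemiAnbd2006, Cor 3.9 p.43] -/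
theorem centralizer_le_verticial_of_topCyclic_of_isAcyclic (hbase : 𝒢.graph.subdivision.IsAcyclic)
    (hcyc : ∀ e : 𝒢.graph.Edge, ∃ t₀ : 𝒢.Ge e, (Subgroup.zpowers t₀).topologicalClosure = ⊤)
    (C : Subgroup (𝒢.temperedPiChart h37.toProp36Hypotheses).G)
    (hCc : IsCompact (C : Set (𝒢.temperedPiChart h37.toProp36Hypotheses).G)) (hC : C ≠ ⊥)
    {v₀ u₀ : 𝒢.graph.Vertex} {b₀ b₀' : 𝒢.graph.Branch} (hb₀ : 𝒢.graph.abuts b₀ = some v₀)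
    (hb₀' : 𝒢.graph.abuts b₀' = some u₀) (hbb : b₀ ≠ b₀') (he : 𝒢.graph.edgeOf b₀' = 𝒢.graph.edgeOf b₀)
    (hvu : v₀ ≠ u₀) {H₀ H₁ : Subgroup (𝒢.temperedPiChart h37.toProp36Hypotheses).G}
    (hH₀ : H₀ ∈ verticialSubgroups (𝒢.temperedPiChart h37.toProp36Hypotheses) v₀)
    (hH₁ : H₁ ∈ verticialSubgroups (𝒢.temperedPiChart h37.toProp36Hypotheses) u₀)
    (hC₀ : C ≤ H₀) (hC₁ : C ≤ H₁)
    {v : 𝒢.graph.Vertex} {H : Subgroup (𝒢.temperedPiChart h37.toProp36Hypotheses).G}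
    (hH : H ∈ verticialSubgroups (𝒢.temperedPiChart h37.toProp36Hypotheses) v) (hCH : C ≤ H) :
    Subgroup.centralizer (C : Set (𝒢.temperedPiChart h37.toProp36Hypotheses).G) ≤ H := by
  intro g hg
  obtain ⟨y, hyc, hyH⟩ := 𝒢.exists_fixed_system_of_mem_verticialSubgroups h37 hH
  have hcomm : ∀ k ∈ C, k * g = g * k := fun k hk => Subgroup.mem_centralizer_iff.mp hg k hk
  have hyC : ∀ k ∈ C, ∀ j,
      ((verticialLevelData_temperedPiChart (h36 := h37.toProp36Hypotheses)).act j k).hom.vertexMap (y j) =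
        y j := fun k hk j => hyH k (hCH hk) j
  have hy₁c := (verticialLevelData_temperedPiChart (h36 := h37.toProp36Hypotheses)).translate_compat' g hyc
  have hy₁C := (verticialLevelData_temperedPiChart (h36 := h37.toProp36Hypotheses)).translate_fixed' hcomm hyC
  refine 𝒢.mem_verticial_of_centralizer_of_confined h37 C hCc hC hH hCH y hyc hyH g hg (𝒢.graph.edgeOf b₀)
    fun k p hp β hβ => ?_
  exact 𝒢.confined_of_topCyclic_of_isAcyclic h37 hbase hcyc C hC hb₀ hb₀' hbb he
    (fun j => 𝒢.exists_fixed_branch_at_host_of_two_hosts h37 hbase C hb₀ hb₀' hbb he hvu hH₀ hH₁ hC₀ hC₁ j)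
    (fun j => 𝒢.exists_fixed_branch_at_host_of_two_hosts h37 hbase C hb₀' hb₀ hbb.symm he.symm hvu.symm hH₁
      hH₀ hC₁ hC₀ j)
    y _ hyc hy₁c hyC hy₁C k p hp β hβ

variable {𝒢} {ℋ : ProfiniteSemiGraph.{u}}

/-- In a semi-graph with acyclic subdivision an edge with two abutting branches joins two DISTINCT vertices
(a loop would give two distinct paths from the vertex-point to the edge-point).
[cite: MochizukiSemiAnbd2006, §1 p.13] -/
theorem ne_of_abuts_of_isAcyclic (hbase : ℋ.graph.subdivision.IsAcyclic) {e : ℋ.graph.Edge}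
    {b₁ b₂ : ℋ.graph.Branch} (hb : b₁ ≠ b₂) (hb₁ : ℋ.graph.edgeOf b₁ = e) (hb₂ : ℋ.graph.edgeOf b₂ = e)
    {w₁ w₂ : ℋ.graph.Vertex} (hw₁ : ℋ.graph.abuts b₁ = some w₁) (hw₂ : ℋ.graph.abuts b₂ = some w₂) :
    w₁ ≠ w₂ := by
  rintro rfl
  have a₁ : ℋ.graph.subdivision.Adj (Sum.inl w₁) (Sum.inr (Sum.inr b₁)) :=
    (ℋ.graph.subdivision_adj_inl_iff w₁ _).mpr ⟨b₁, hw₁, rfl⟩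
  have a₁' : ℋ.graph.subdivision.Adj (Sum.inr (Sum.inr b₁)) (Sum.inr (Sum.inl e)) :=
    (ℋ.graph.subdivision_adj_branch_iff b₁ _).mpr (Or.inl (by rw [hb₁]))
  have a₂ : ℋ.graph.subdivision.Adj (Sum.inl w₁) (Sum.inr (Sum.inr b₂)) :=
    (ℋ.graph.subdivision_adj_inl_iff w₁ _).mpr ⟨b₂, hw₂, rfl⟩
  have a₂' : ℋ.graph.subdivision.Adj (Sum.inr (Sum.inr b₂)) (Sum.inr (Sum.inl e)) :=
    (ℋ.graph.subdivision_adj_branch_iff b₂ _).mpr (Or.inl (by rw [hb₂]))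
  let T₁ : ℋ.graph.subdivision.Walk (Sum.inl w₁) (Sum.inr (Sum.inl e)) :=
    SimpleGraph.Walk.cons a₁ (SimpleGraph.Walk.cons a₁' SimpleGraph.Walk.nil)
  let T₂ : ℋ.graph.subdivision.Walk (Sum.inl w₁) (Sum.inr (Sum.inl e)) :=
    SimpleGraph.Walk.cons a₂ (SimpleGraph.Walk.cons a₂' SimpleGraph.Walk.nil)
  have hT₁ : T₁.IsPath := SimpleGraph.Walk.IsPath.mk' (by simp [T₁])
  have hT₂ : T₂.IsPath := SimpleGraph.Walk.IsPath.mk' (by simp [T₂])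
  have h := congrArg (fun q : ℋ.graph.subdivision.Path _ _ => q.1.getVert 1) (hbase.path_unique ⟨T₁, hT₁⟩ ⟨T₂, hT₂⟩)
  simp [T₁, T₂] at h
  exact hb h

/-- **(R3c) F-2772 `EdgeLikeCentralizerAt ℋ c` at EVERY chart of every TREE-shaped graph of anabelioids with
TOPOLOGICALLY CYCLIC edge groups** satisfying the hypotheses of [SemiAnbd] Cor. 3.9 — any valence, in
particular at every vertex of infinite valence and on every infinitely-branching core (e.g. the ℵ₀-regular
tree with procyclic branch groups).  The open piece `ψ(U)` is compact and nontrivial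
(`isCompact_map_and_ne_bot_of_isEdgeHom`), has verticial hosts at both ends of `e`
(`exists_verticial_pair_of_mem_edgeLikeSubgroups`), and the canonical-chart statement
`centralizer_le_verticial_of_topCyclic_of_isAcyclic` is transported along `TemperedPiChart.exists_compatIso`.
[cite: MochizukiSemiAnbd2006, Cor 3.9 p.43] -/
theorem edgeLikeCentralizerAt_of_topCyclic_of_isAcyclic (hℋ : Cor39Hypotheses ℋ)
    (hbase : ℋ.graph.subdivision.IsAcyclic)
    (hcyc : ∀ e : ℋ.graph.Edge, ∃ t₀ : ℋ.Ge e, (Subgroup.zpowers t₀).topologicalClosure = ⊤)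
    (c : TemperedPiChart ℋ) : EdgeLikeCentralizerAt ℋ c := by
  intro e ψ hψ U hU v H hH hUH
  have h37 : ℋ.Thm37Hypotheses := hℋ.thm37Hypotheses
  obtain ⟨hCc, hC⟩ := isCompact_map_and_ne_bot_of_isEdgeHom hℋ c e ψ hψ U hU
  -- the two end-vertex hosts of `ψ(U)`
  obtain ⟨b₁, b₂, hb12, hb₁e, hb₂e, -⟩ := ℋ.graph.two_branches e
  obtain ⟨w₁, hw₁⟩ := Option.isSome_iff_exists.mp (hℋ.isGraph.abuts_isSome b₁)
  obtain ⟨w₂, hw₂⟩ := Option.isSome_iff_exists.mp (hℋ.isGraph.abuts_isSome b₂)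
  obtain ⟨H₁, hH₁, H₂, hH₂, -, hL1, hL2⟩ :=
    exists_verticial_pair_of_mem_edgeLikeSubgroups verticialInjective_holds hℋ c hb12 hb₁e hb₂e hw₁ hw₂
      (⟨ψ, hψ, rfl⟩ : ψ.toMonoidHom.range ∈ edgeLikeSubgroups c e)
  have hC1 : U.map ψ.toMonoidHom ≤ H₁ := (Subgroup.map_le_range _ _).trans hL1
  have hC2 : U.map ψ.toMonoidHom ≤ H₂ := (Subgroup.map_le_range _ _).trans hL2
  have hw : w₁ ≠ w₂ := ne_of_abuts_of_isAcyclic hbase hb12 hb₁e hb₂e hw₁ hw₂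
  -- transport to the canonical chart `c₀`
  obtain ⟨φ, ψ', hψφ, hφψ, hφ, hψ'⟩ :=
    TemperedPiChart.exists_compatIso (ℋ.temperedPiChart h37.toProp36Hypotheses) c
  have hinj : Function.Injective ψ' := fun y₁ y₂ h => by rw [← hφψ y₁, ← hφψ y₂, h]
  have hmapV : ∀ {w : ℋ.graph.Vertex} {K : Subgroup c.G}, K ∈ verticialSubgroups c w →
      K.map ψ'.toMonoidHom ∈ verticialSubgroups (ℋ.temperedPiChart h37.toProp36Hypotheses) w :=
    fun hK => (mem_verticialSubgroups_iff_map φ hφ ψ' hφψ hψ' _).mp hK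
  have hC₀c : IsCompact (((U.map ψ.toMonoidHom).map ψ'.toMonoidHom :
      Subgroup (ℋ.temperedPiChart h37.toProp36Hypotheses).G) :
        Set (ℋ.temperedPiChart h37.toProp36Hypotheses).G) := by
    rw [Subgroup.coe_map]
    exact hCc.image ψ'.continuous
  have hC₀ : (U.map ψ.toMonoidHom).map ψ'.toMonoidHom ≠ ⊥ := fun h0 =>
    hC ((Subgroup.map_eq_bot_iff_of_injective (U.map ψ.toMonoidHom) hinj).mp h0)
  intro g hg
  have hg₀ : ψ' g ∈ Subgroup.centralizer ((((U.map ψ.toMonoidHom).map ψ'.toMonoidHom :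
      Subgroup (ℋ.temperedPiChart h37.toProp36Hypotheses).G)) :
        Set (ℋ.temperedPiChart h37.toProp36Hypotheses).G) := by
    refine Subgroup.mem_centralizer_iff.mpr ?_
    rintro _ ⟨k, hk, rfl⟩
    have hkg : k * g = g * k := Subgroup.mem_centralizer_iff.mp hg k hk
    change ψ' k * ψ' g = ψ' g * ψ' k
    rw [← map_mul, ← map_mul, hkg]
  have hmem : ψ' g ∈ H.map ψ'.toMonoidHom :=
    ℋ.centralizer_le_verticial_of_topCyclic_of_isAcyclic h37 hbase hcyc _ hC₀c hC₀ hw₁ hw₂ hb12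
      (hb₂e.trans hb₁e.symm) hw (hmapV hH₁) (hmapV hH₂) (Subgroup.map_mono hC1) (Subgroup.map_mono hC2)
      (hmapV hH) (Subgroup.map_mono hUH) hg₀
  obtain ⟨h, hh, hhg⟩ := hmem
  have hhg' : h = g := hinj hhg
  exact hhg' ▸ hh

/-- **F-2773 `EdgeLikeCentralizer` RESTRICTED to tree-shaped graphs with topologically cyclic edge groups,
hypothesis-free.**  (The bare ∀-countable fact additionally ranges over graphs with an infinitely-branching
core carrying a NON-topologically-cyclic edge group, or with cycles — not claimed.)
[cite: MochizukiSemiAnbd2006, Cor 3.9 p.43] -/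
theorem edgeLikeCentralizer_of_topCyclic_of_isAcyclic :
    ∀ (ℋ : ProfiniteSemiGraph.{u}), Cor39Hypotheses ℋ → ℋ.graph.subdivision.IsAcyclic →
      (∀ e : ℋ.graph.Edge, ∃ t₀ : ℋ.Ge e, (Subgroup.zpowers t₀).topologicalClosure = ⊤) →
      ∀ (c : TemperedPiChart ℋ), EdgeLikeCentralizerAt ℋ c :=
  fun _ hℋ hbase hcyc c => edgeLikeCentralizerAt_of_topCyclic_of_isAcyclic hℋ hbase hcyc c

end ProfiniteSemiGraph

end Literature.AnabelianGeometry.SemiGraphs
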